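import Mathlib
import Summits.Ventures.PercRepro2.HCov
import Summits.Ventures.PercRepro2.HCovSwap
import Summits.Ventures.PercRepro2.RV
import Summits.Ventures.PercRepro2.RVBridge
import Summits.Ventures.PercRepro2.K5Kernel
import Summits.Ventures.PercRepro2.K5Conn
import Summits.Ventures.PercRepro2.K5Kron
import Summits.Ventures.PercRepro2.K5Digits
import Summits.Ventures.PercRepro2.K5Theorem
import Summits.Ventures.PercRepro2.K5TheoremI

/-!
# Transfer: `K₅` is universal for the five-vertex instances
(blind cell PercRepro2, typer-1 g9; lead g26 01:59:27Z «the transfer lemma to an arbitrary 5-vertex type»)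

Let `ends : E → Sym2 V` be ANY finite graph (parallel edges and loops allowed) on a vertex type `V` with
`ι : V ≃ Fin 5`, weights `p : E → R`.  The PATTERN `pattern ω : Fin 10 → Bool` records, for each of the ten
pairs of `K₅`, whether some edge of `G` joining that pair is open; `bundleProb p j = 1 − ∏_{e in the bundle}(1 − p_e)`.
* `openAdj_iff`, `conn_iff_pattern`: `ι` is an isomorphism of open graphs `G_ω ≃g K₅_{pattern ω}`, so
  `Conn ends ω u v ↔ Conn ends5 (pattern ω) (ι u) (ι v)` — every connectivity event of `G` is the preimage
  of the corresponding event of `K₅`;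
* `prob_pattern_eq`: the law of the pattern is the product law `weight (bundleProb p)` (the ten bundles
  are disjoint edge sets, `prob_inter_eq_mul_of_dependsOn`, and a bundle is open with probability
  `1 − ∏(1 − p_e)`, `prob_allClosed`); hence `prob_preimage`: `P_p(pattern⁻¹ A) = P_{p′}(A)`.
* **`caseOneRV_five`**: `CaseOne.RV p ends o a₁ a₂ a₃ b` for every admissible `p` and every five distinct marks
  `ι o = 0, …, ι b = 4` — (RV) on EVERY graph on five vertices, every marking, every weight vector,
  from `K5Theorem.caseOneRV_K5` at the bundle weights; likewise **`zSplitI_five`** ((i)) and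
  **`jOneOne_five`** ((J1₁)) from `K5TheoremI`.
-/

namespace Summit.Ventures.PercRepro2

namespace K5

section Pattern

variable {V : Type*} {E : Type*} [Fintype E] [DecidableEq E] [DecidableEq V]
variable (ι : V ≃ Fin 5) (ends : E → Sym2 V)

/-- The pair `j` of `K₅`, pulled back to `V`. -/
def pairV (j : Fin 10) : Sym2 V := s(ι.symm (edge5 j).1, ι.symm (edge5 j).2)

/-- The bundle of the pair `j`: the edges of `G` joining the two vertices of the pair. -/
def bundle (j : Fin 10) : Finset E := Finset.univ.filter fun e => ends e = pairV ι j

/-- The pattern of a configuration: which pairs of `K₅` carry an open edge of `G`. -/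
def pattern (ω : Config E) : Fin 10 → Bool := fun j => decide (∃ e ∈ bundle ι ends j, ω e = true)

/-- Distinct pairs of `K₅` have distinct edges: `ends5 j = ends5 j'` only for `j = j'`. -/
lemma ends5_injective : Function.Injective ends5 := by
  intro j j' h
  revert j j'
  decide

omit [DecidableEq V] in
/-- The pair `pairV ι j` is the image of `ends5 j` under `ι.symm`. -/
lemma pairV_eq (j : Fin 10) : pairV ι j = (ends5 j).map ι.symm := by
  unfold pairV ends5
  rfl

/-- Every unordered pair of distinct marks is an edge of `K₅`. -/
lemma exists_edge5 : ∀ x y : Fin 5, x ≠ y → ∃ j, ends5 j = s(x, y) := by decide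

omit [DecidableEq E] in
/-- The bundles are pairwise disjoint. -/
lemma bundle_disjoint {j j' : Fin 10} (h : j ≠ j') : Disjoint (bundle ι ends j) (bundle ι ends j') := by
  rw [Finset.disjoint_left]
  intro e he he'
  unfold bundle at he he'
  rw [Finset.mem_filter] at he he'
  apply h
  apply ends5_injective
  have : pairV ι j = pairV ι j' := he.2.symm.trans he'.2
  rw [pairV_eq, pairV_eq] at this
  have := congrArg (Sym2.map ι) this
  rw [Sym2.map_map, Sym2.map_map, show (ι ∘ ι.symm) = id from funext ι.apply_symm_apply] at this
  simpa using this

omit [DecidableEq E] in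
/-- **Open adjacency transports along `ι`**: for `u ≠ v`, `G_ω` has an open edge `{u, v}` iff the pattern
has the pair `{ι u, ι v}`. -/
lemma openAdj_iff (ω : Config E) {u v : V} (huv : u ≠ v) :
    OpenAdj ends ω u v ↔ OpenAdj ends5 (pattern ι ends ω) (ι u) (ι v) := by
  obtain ⟨j, hj⟩ := exists_edge5 (ι u) (ι v) (fun h => huv (ι.injective h))
  have hpair : pairV ι j = s(u, v) := by
    rw [pairV_eq, hj]
    simp
  constructor
  · rintro ⟨e, he, hends⟩
    refine ⟨j, ?_, hj⟩
    unfold pattern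
    rw [decide_eq_true_iff]
    refine ⟨e, ?_, he⟩
    unfold bundle
    rw [Finset.mem_filter]
    exact ⟨Finset.mem_univ _, hends.trans hpair.symm⟩
  · rintro ⟨j', hj', hends'⟩
    have hjj : j' = j := ends5_injective (hends'.trans hj.symm)
    subst hjj
    unfold pattern at hj'
    rw [decide_eq_true_iff] at hj'
    obtain ⟨e, he, hωe⟩ := hj'
    unfold bundle at he
    rw [Finset.mem_filter] at he
    exact ⟨e, hωe, he.2.trans hpair⟩

/-- The open graph of `G` at `ω` is isomorphic to the open graph of `K₅` at the pattern, via `ι`. -/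
def openIso (ω : Config E) : openGraph ends ω ≃g openGraph ends5 (pattern ι ends ω) where
  toEquiv := ι
  map_rel_iff' := by
    intro u v
    rw [openGraph_adj, openGraph_adj]
    constructor
    · rintro ⟨hne, hadj⟩
      have huv : u ≠ v := fun h => hne (by rw [h])
      exact ⟨huv, (openAdj_iff ι ends ω huv).2 hadj⟩
    · rintro ⟨huv, hadj⟩
      exact ⟨fun h => huv (ι.injective h), (openAdj_iff ι ends ω huv).1 hadj⟩

omit [DecidableEq E] in
/-- **Connectivity transports along `ι`**: `Conn ends ω u v ↔ Conn ends5 (pattern ω) (ι u) (ι v)`. -/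
theorem conn_iff_pattern (ω : Config E) (u v : V) :
    Conn ends ω u v ↔ Conn ends5 (pattern ι ends ω) (ι u) (ι v) :=
  (SimpleGraph.Iso.reachable_iff (φ := openIso ι ends ω)).symm

end Pattern

/-! ## The law of the pattern is the product law of the bundle weights -/

section Law

variable {V : Type*} {E : Type*} [Fintype E] [DecidableEq E] [DecidableEq V]
  {R : Type*} [Field R] [LinearOrder R] [IsStrictOrderedRing R]
variable (ι : V ≃ Fin 5) (ends : E → Sym2 V)

/-- The bundle weights: the probability that the pair `j` carries an open edge. -/
def bundleProb (p : E → R) (j : Fin 10) : R := 1 - ∏ e ∈ bundle ι ends j, (1 - p e)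

omit [DecidableEq E] in
/-- The bundle weights are admissible. -/
lemma isProbVec_bundleProb {p : E → R} (hp : IsProbVec p) : IsProbVec (bundleProb ι ends p) where
  nonneg j := by
    unfold bundleProb
    rw [sub_nonneg]
    exact Finset.prod_le_one (fun e _ => sub_nonneg.2 (hp.le_one e)) (fun e _ => by linarith [hp.nonneg e])
  le_one j := by
    unfold bundleProb
    linarith [Finset.prod_nonneg (s := bundle ι ends j) (f := fun e => 1 - p e)
      (fun e _ => sub_nonneg.2 (hp.le_one e))]

/-- The event `{pattern ω j = σ j}`. -/
def patEvent (σ : Fin 10 → Bool) (j : Fin 10) : Set (Config E) := {ω | pattern ι ends ω j = σ j}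

omit [DecidableEq E] in
/-- `{pattern ω j = σ j}` is determined by the bundle `j`. -/
lemma dependsOn_patEvent (σ : Fin 10 → Bool) (j : Fin 10) :
    DependsOn (· ∈ patEvent ι ends σ j) (↑(bundle ι ends j) : Set E) := by
  intro ω ω' h
  simp only [patEvent, Set.mem_setOf_eq, pattern]
  have : (∃ e ∈ bundle ι ends j, ω e = true) ↔ ∃ e ∈ bundle ι ends j, ω' e = true := by
    constructor
    · rintro ⟨e, he, hω⟩; exact ⟨e, he, by rw [← h e he]; exact hω⟩
    · rintro ⟨e, he, hω⟩; exact ⟨e, he, by rw [h e he]; exact hω⟩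
  exact congrArg (fun b : Bool => b = σ j) (decide_eq_decide.2 this)

omit [LinearOrder R] [IsStrictOrderedRing R] in
/-- The probability that the pair `j` shows the state `σ j`. -/
lemma prob_patEvent (p : E → R) (σ : Fin 10 → Bool) (j : Fin 10) :
    prob p (patEvent ι ends σ j) = edgeFactor (bundleProb ι ends p j) (σ j) := by
  have hclosed : prob p (allClosed (bundle ι ends j)) = 1 - bundleProb ι ends p j := by
    rw [prob_allClosed]; unfold bundleProb; ring
  cases hσ : σ j
  · have : patEvent ι ends σ j = allClosed (bundle ι ends j) := by
      ext ω
      simp only [patEvent, Set.mem_setOf_eq, hσ, mem_allClosed, pattern, decide_eq_false_iff_not]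
      constructor
      · intro h e he
        cases hω : ω e
        · rfl
        · exact absurd ⟨e, he, hω⟩ h
      · rintro h ⟨e, he, hω⟩
        rw [h e he] at hω
        exact Bool.false_ne_true hω
    rw [this, hclosed]; rfl
  · have : patEvent ι ends σ j = (allClosed (bundle ι ends j))ᶜ := by
      ext ω
      simp only [patEvent, Set.mem_setOf_eq, hσ, Set.mem_compl_iff, mem_allClosed, pattern,
        decide_eq_true_iff]
      constructor
      · rintro ⟨e, he, hω⟩ hall
        rw [hall e he] at hω
        exact Bool.false_ne_true hω
      · intro h
        by_contra hcon
        apply h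
        intro e he
        cases hω : ω e
        · rfl
        · exact absurd ⟨e, he, hω⟩ hcon
    rw [this, prob_compl, hclosed]; simp [edgeFactor]

omit [LinearOrder R] [IsStrictOrderedRing R] in
/-- **Independence of the bundles**: the probability of a conjunction of pattern events over a set of pairs
is the product. -/
lemma prob_biInter_patEvent (p : E → R) (σ : Fin 10 → Bool) (s : Finset (Fin 10)) :
    prob p (⋂ j ∈ s, patEvent ι ends σ j) = ∏ j ∈ s, prob p (patEvent ι ends σ j) ∧
    DependsOn (· ∈ ⋂ j ∈ s, patEvent ι ends σ j) (↑(s.biUnion (bundle ι ends)) : Set E) := by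
  induction s using Finset.induction_on with
  | empty =>
    refine ⟨by simp, ?_⟩
    intro ω ω' _
    simp
  | insert j s hj ih =>
    obtain ⟨ih1, ih2⟩ := ih
    have hdisj : Disjoint (↑(bundle ι ends j) : Set E) (↑(s.biUnion (bundle ι ends)) : Set E) := by
      rw [Set.disjoint_left]
      intro e he he'
      rw [Finset.mem_coe, Finset.mem_biUnion] at he'
      obtain ⟨j', hj', he'⟩ := he'
      have : j ≠ j' := fun h => hj (h ▸ hj')
      exact Finset.disjoint_left.1 (bundle_disjoint ι ends this) (Finset.mem_coe.1 he) he'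
    rw [Finset.set_biInter_insert]
    refine ⟨?_, ?_⟩
    · rw [prob_inter_eq_mul_of_dependsOn p hdisj (dependsOn_patEvent ι ends σ j) ih2, ih1,
        Finset.prod_insert hj]
    · have := dependsOn_inter (dependsOn_patEvent ι ends σ j) ih2
      rw [Finset.biUnion_insert, Finset.coe_union]
      exact this

omit [DecidableEq E] in
/-- The fibre of the pattern map is the conjunction of the pattern events. -/
lemma fibre_eq (σ : Fin 10 → Bool) :
    {ω : Config E | pattern ι ends ω = σ} = ⋂ j ∈ (Finset.univ : Finset (Fin 10)), patEvent ι ends σ j := by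
  ext ω
  simp only [Set.mem_setOf_eq, Set.mem_iInter, Finset.mem_univ, patEvent, true_implies]
  exact ⟨fun h j => by rw [h], fun h => funext h⟩

omit [LinearOrder R] [IsStrictOrderedRing R] in
/-- **The law of the pattern is the product law of the bundle weights.** -/
theorem prob_pattern_eq (p : E → R) (σ : Fin 10 → Bool) :
    prob p {ω | pattern ι ends ω = σ} = weight (bundleProb ι ends p) σ := by
  rw [fibre_eq, (prob_biInter_patEvent ι ends p σ Finset.univ).1]
  unfold weight
  exact Finset.prod_congr rfl fun j _ => prob_patEvent ι ends p σ j

omit [LinearOrder R] [IsStrictOrderedRing R] in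
/-- **Pushforward**: the probability of a pattern event in `G` is its probability in `K₅` at the bundle
weights. -/
theorem prob_preimage (p : E → R) (A : Set (Config (Fin 10))) :
    prob p (pattern ι ends ⁻¹' A) = prob (bundleProb ι ends p) A := by
  classical
  calc prob p (pattern ι ends ⁻¹' A)
      = ∑ ω, (pattern ι ends ⁻¹' A).indicator (weight p) ω := rfl
    _ = ∑ σ, ∑ ω ∈ Finset.univ.filter (fun ω => pattern ι ends ω = σ),
          (pattern ι ends ⁻¹' A).indicator (weight p) ω :=
        (Finset.sum_fiberwise Finset.univ (pattern ι ends) _).symm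
    _ = ∑ σ, A.indicator (fun σ => prob p {ω | pattern ι ends ω = σ}) σ := by
        refine Finset.sum_congr rfl fun σ _ => ?_
        by_cases hA : σ ∈ A
        · rw [Set.indicator_of_mem hA]
          unfold prob
          rw [Finset.sum_filter]
          refine Finset.sum_congr rfl fun ω _ => ?_
          by_cases hω : pattern ι ends ω = σ
          · rw [if_pos hω, Set.indicator_of_mem (show ω ∈ {ω | pattern ι ends ω = σ} from hω),
              Set.indicator_of_mem (show ω ∈ pattern ι ends ⁻¹' A from by
                rw [Set.mem_preimage, hω]; exact hA)]
          · rw [if_neg hω, Set.indicator_of_notMem (show ω ∉ {ω | pattern ι ends ω = σ} from hω)]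
        · rw [Set.indicator_of_notMem hA]
          refine Finset.sum_eq_zero fun ω hω => ?_
          rw [Finset.mem_filter] at hω
          rw [Set.indicator_of_notMem]
          rw [Set.mem_preimage, hω.2]
          exact hA
    _ = ∑ σ, A.indicator (weight (bundleProb ι ends p)) σ := by
        refine Finset.sum_congr rfl fun σ _ => ?_
        by_cases hA : σ ∈ A
        · rw [Set.indicator_of_mem hA, Set.indicator_of_mem hA, prob_pattern_eq]
        · rw [Set.indicator_of_notMem hA, Set.indicator_of_notMem hA]
    _ = prob (bundleProb ι ends p) A := rfl

end Law

/-! ## The events transport -/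

section Events

variable {V : Type*} {E : Type*} [Fintype E] [DecidableEq E] [DecidableEq V]
variable (ι : V ≃ Fin 5) (ends : E → Sym2 V)

omit [DecidableEq E] in
/-- Connection events are preimages. -/
lemma connEvent_eq_preimage (u v : V) :
    connEvent ends u v = pattern ι ends ⁻¹' connEvent ends5 (ι u) (ι v) := by
  ext ω
  exact conn_iff_pattern ι ends ω u v

omit [DecidableEq E] in
/-- `Q` is a preimage. -/
lemma avoidAll_eq_preimage (a₁ a₂ : V) :
    avoidAll ends a₂ {a₁} = pattern ι ends ⁻¹' avoidAll ends5 (ι a₂) {ι a₁} := by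
  ext ω
  simp only [mem_avoidAll, Finset.mem_singleton, forall_eq, Set.mem_preimage]
  rw [conn_iff_pattern ι ends ω a₂ a₁]

omit [DecidableEq E] in
/-- `PD` is a preimage. -/
lemma PDEvent_eq_preimage (a₁ a₂ a₃ : V) :
    PDEvent ends a₁ a₂ a₃ = pattern ι ends ⁻¹' PDEvent ends5 (ι a₁) (ι a₂) (ι a₃) := by
  ext ω
  simp only [PDEvent, Dtilde, UnionCluster.inU, Set.mem_inter_iff, Set.mem_compl_iff, Set.mem_union,
    mem_connEvent, Set.mem_preimage]
  rw [conn_iff_pattern ι ends ω a₁ a₂, conn_iff_pattern ι ends ω a₃ a₁, conn_iff_pattern ι ends ω a₃ a₂]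

end Events

/-! ## (RV) on every five-vertex instance -/

section Transfer

variable {V : Type*} {E : Type*} [Fintype E] [DecidableEq E] [DecidableEq V]
  {R : Type*} [Field R] [LinearOrder R] [IsStrictOrderedRing R]
variable (ι : V ≃ Fin 5) (ends : E → Sym2 V)

omit [LinearOrder R] [IsStrictOrderedRing R] in
/-- The cleared (ii) of `G` is the cleared (ii) of `K₅` at the bundle weights. -/
theorem rvTableExpr_eq_transfer (p : E → R) (o a₁ a₂ a₃ b : V) (h₀ : ι o = 0) (h₁ : ι a₁ = 1)
    (h₂ : ι a₂ = 2) (h₃ : ι a₃ = 3) (h₄ : ι b = 4) :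
    J1RV.rvTableExpr p ends o a₁ a₂ a₃ b = J1RV.rvTableExpr (bundleProb ι ends p) ends5 0 1 2 3 4 := by
  unfold J1RV.rvTableExpr J1RV.pQ J1RV.pQb J1RV.pT1 J1RV.pT1b J1RV.pT1o J1RV.pT1ob CovForm.Do
  rw [avoidAll_eq_preimage ι ends, PDEvent_eq_preimage ι ends, connEvent_eq_preimage ι ends a₁ a₃,
    connEvent_eq_preimage ι ends a₂ o, connEvent_eq_preimage ι ends a₂ b, connEvent_eq_preimage ι ends a₁ o,
    h₀, h₁, h₂, h₃, h₄]
  simp only [← Set.preimage_inter, prob_preimage]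

/-- **(RV) on every graph on five vertices, every marking, every weight vector**: for `ι : V ≃ Fin 5`
sending the five marks to `0, 1, 2, 3, 4`, `CaseOne.RV p ends o a₁ a₂ a₃ b`. -/
theorem caseOneRV_five (p : E → R) (hp : IsProbVec p) (o a₁ a₂ a₃ b : V) (h₀ : ι o = 0) (h₁ : ι a₁ = 1)
    (h₂ : ι a₂ = 2) (h₃ : ι a₃ = 3) (h₄ : ι b = 4) : CaseOne.RV p ends o a₁ a₂ a₃ b := by
  refine (J1RV.RV_iff p ends o a₁ a₂ a₃ b).1 (J1RV.rv_of_rvTable p hp ends o a₁ a₂ a₃ b ?_)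
  unfold J1RV.RVTable
  rw [rvTableExpr_eq_transfer ι ends p o a₁ a₂ a₃ b h₀ h₁ h₂ h₃ h₄]
  exact rvTable_K5 (bundleProb ι ends p) (isProbVec_bundleProb ι ends hp)

omit [LinearOrder R] [IsStrictOrderedRing R] in
/-- The cleared (i) of `G` is the cleared (i) of `K₅` at the bundle weights. -/
theorem iExpr_eq_transfer (p : E → R) (o a₁ a₂ a₃ b : V) (h₀ : ι o = 0) (h₁ : ι a₁ = 1)
    (h₂ : ι a₂ = 2) (h₃ : ι a₃ = 3) (h₄ : ι b = 4) :
    CaseOne.iExpr p ends o a₁ a₂ a₃ b = CaseOne.iExpr (bundleProb ι ends p) ends5 0 1 2 3 4 := by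
  rw [iExpr_eq_probs, iExpr_eq_probs]
  unfold CaseOne.Dpd CaseOne.Dpdo
  rw [connEvent_eq_preimage ι ends a₁ a₂, connEvent_eq_preimage ι ends a₁ b,
    connEvent_eq_preimage ι ends a₁ a₃, connEvent_eq_preimage ι ends a₂ o,
    connEvent_eq_preimage ι ends a₂ a₃, connEvent_eq_preimage ι ends a₁ o, h₀, h₁, h₂, h₃, h₄]
  simp only [← Set.preimage_compl, ← Set.preimage_inter, ← Set.preimage_union, prob_preimage]

/-- **(i) on every graph on five vertices, every marking, every weight vector.** -/
theorem zSplitI_five (p : E → R) (hp : IsProbVec p) (o a₁ a₂ a₃ b : V) (h₀ : ι o = 0) (h₁ : ι a₁ = 1)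
    (h₂ : ι a₂ = 2) (h₃ : ι a₃ = 3) (h₄ : ι b = 4) : CaseOne.ZSplitI p ends o a₁ a₂ a₃ b := by
  unfold CaseOne.ZSplitI
  rw [iExpr_eq_transfer ι ends p o a₁ a₂ a₃ b h₀ h₁ h₂ h₃ h₄]
  exact zSplitI_K5 (bundleProb ι ends p) (isProbVec_bundleProb ι ends hp)

/-- **(ii) on every graph on five vertices** (`CaseOne.ZSplitII`). -/
theorem zSplitII_five (p : E → R) (hp : IsProbVec p) (o a₁ a₂ a₃ b : V) (h₀ : ι o = 0) (h₁ : ι a₁ = 1)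
    (h₂ : ι a₂ = 2) (h₃ : ι a₃ = 3) (h₄ : ι b = 4) : CaseOne.ZSplitII p ends o a₁ a₂ a₃ b := by
  refine (J1RV.RVTable_iff p ends o a₁ a₂ a₃ b).1 ?_
  unfold J1RV.RVTable
  rw [rvTableExpr_eq_transfer ι ends p o a₁ a₂ a₃ b h₀ h₁ h₂ h₃ h₄]
  exact rvTable_K5 (bundleProb ι ends p) (isProbVec_bundleProb ι ends hp)

/-- **(J1₁) on every graph on five vertices, every marking, every weight vector.** -/
theorem jOneOne_five (p : E → R) (hp : IsProbVec p) (o a₁ a₂ a₃ b : V) (h₀ : ι o = 0) (h₁ : ι a₁ = 1)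
    (h₂ : ι a₂ = 2) (h₃ : ι a₃ = 3) (h₄ : ι b = 4) : CaseOne.JOneOne p ends o a₁ a₂ a₃ b :=
  CaseOne.jOneOne_of_i_of_ii p ends o a₁ a₂ a₃ b (zSplitI_five ι ends p hp o a₁ a₂ a₃ b h₀ h₁ h₂ h₃ h₄)
    (zSplitII_five ι ends p hp o a₁ a₂ a₃ b h₀ h₁ h₂ h₃ h₄)

end Transfer

end K5

end Summit.Ventures.PercRepro2
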